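import Summits.QuantumFields.BalabanUV.T4Continuum.Support.NE7TopNormalisedSpikeEnergyLetters
import Summits.QuantumFields.BalabanUV.T4Continuum.Support.NE3CurlOfGaugeDir
import Summits.QuantumFields.BalabanUV.T4Continuum.Support.NE3DirIterMajorant
import HarnessLib

/-!
# Support | NE7 (gen 98, ROAD-Γ′ S4b, part 1 — THE TWO ENERGY LETTERS OF A PURE GAUGE PIECE): for a unitary `W` with `SmallField W x` and an
# `(N·M)`-periodic gauge generator `μ`, the gauge direction `gaugeDir W μ` obeys `‖gaugeDir W μ‖_w ≤ √((4x²·#Plane + 4d·M⁻²)·Σ_{[0,N·M)^d}‖μ‖²)` and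
# `x·Σ_{perWin(N·M)}‖curl_W (gaugeDir W μ)‖ ≤ 2x²·#Plane·Σ_{[0,N·M)^d}‖μ‖` (`‖·‖_w = energyNormW L (j+1) W · [0,N·M)^d`, `M = L^{j+1}`)

Cell `pub-balaban`, rung (B)+1 sub-cell t4, lineage `b2b-balaban-t4-ne7-p1` (CRUX PROVER NE7 #1 = OWNER of row NE7), generation 98; memo `t4/b2b-balaban-t4-ne7-p1-g98/ROAD-G98.md` §3.
Over row NE3's `NE3CurlOfGaugeDir.curlSq_gaugeDir_le ∕ norm_curlAt_gaugeDir_le` (the linearised curl of a gauge direction is the commutator with the plaquette deviation)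
and `NE3DirIterMajorant.norm_gaugeDir_le` (`‖gaugeDir W f z κ‖ ≤ ‖f z‖ + ‖f(z + e_κ)‖`), with the periodic shift `T4AveragingDeficitWallBoundary.sum_periodBox_shift`.

WHY (memo ROAD-G97 §4 S4, ROAD-G98 §3).  The third piece of ROAD-Γ′'s normal part is `−gaugeDir W μ` with `μ = μ₁ + η` (leaf-02's curved frame-kill `μ₁` plus the Riesz
projection `η ∈ Ξ₀₀(W)`, `NE3FrameFreeDecompositionW.exists_cornerGauge_mem_frameFreeBlockLandauW`) applied to the tangent residual `X − X_N⁰` of part S4a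
(`NE7TopNormalisedResidualLetters.tangentResidual_letters_of_frameTrivial`).  Its ν- and κ-letters in the binder's currency are PURELY KINEMATIC once the ℓ² mass
`Σ‖μ‖²` and the ℓ¹ mass `Σ‖μ‖` of the generator over one period are known: THIS FILE states them for an arbitrary periodic generator, so that S5 only has to supply
the two masses (the ℓ² mass from Pythagoras `NE7SliceLinearSplit.riesz_pythagoras` + the block Poincaré inequality, the ℓ¹ mass from the Green's-function letter (G)
of memo §2 — both NOT here).
WHAT ([folklore]; 0 def, 0 sorry).  §1 `dirSq_gaugeDir_le_of_periodic` (`dirSq (gaugeDir W μ) [0,P)^d ≤ 4d·Σ_{[0,P)^d}‖μ‖²`), `sum_norm_curl_gaugeDir_le`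
(`Σ_{perWin P}‖curl_W(gaugeDir W μ)‖ ≤ 2x·#Plane·Σ_{[0,P)^d}‖μ‖`); §2 **`energyNormW_gaugeDir_le`**, **`curlL1_gaugeDir_le`** (the two letters at level `j+1`).
HONEST FRAMING (page 1): kinematics over landed kernel theorems; nothing of Bałaban's asserted; the masses of leaf-02's `μ`, `hdecomp♭` and NE7 are NOT proved; spine 0∕9;
finite T⁴ rung (B)+1 — NOT infinite volume, NOT mass gap, NOT `BetaPertH`, NOT Clay.  Continuum YM on T⁴ ⇐ BetaPertH ∧ nine spine estimates (0/9 proved); BetaPertH ⇐ (D1) ∧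
(D4) ∧ CAP+tail; G-an2-4 gates asym, D1 and NE2/3/4.
-/

set_option autoImplicit false

open scoped BigOperators Matrix Matrix.Norms.L2Operator
open NormedSpace Finset

namespace Summit.QuantumFields.BalabanUV.T4Continuum.NE7PureGaugePieceLetters

open Literature.MathematicalPhysics.QuantumFieldTheory.Balaban1983to89
open B7Prop1Explicit B7Prop2Explicit
open T4AveragingDeficitWall (Ad IsUnitaryCfg SmallField curl curlAt dirSq curlSq)
open T4AveragingDeficitWallBoundary (periodBox sum_periodBox_shift)
open BlockAveragePushDirGauge (gaugeDir)
open NE3EnergyWeightedShapes (energyNormW energyNormW_nonneg)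
open NE3EnergyHessContTwoTerm (curlSq_nonneg dirSq_nonneg)
open NE3CurlOfGaugeDir (curlSq_gaugeDir_le norm_curlAt_gaugeDir_le)
open NE3DirIterMajorant (norm_gaugeDir_le)
open MinimalActionLevels (perWin)
open NE7TopNormalisedSpikeEnergyLetters (energyNormW_le_of_sq_le)

noncomputable section

variable {d : ℕ} {n : Type*} [Fintype n] [DecidableEq n]

/-! ## §1 The ℓ² mass and the ℓ¹ curl of a gauge direction over one period -/

/-- **THE ℓ² MASS OF A GAUGE DIRECTION** (`P ≥ 1`, `W` unitary, `μ` with `P`-periodic norms): `dirSq (gaugeDir W μ) [0,P)^d ≤ 4d·Σ_{z∈[0,P)^d}‖μ z‖²` — each bond reads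
the generator at its two ends (`‖gaugeDir W μ z κ‖ ≤ ‖μ z‖ + ‖μ(z+e_κ)‖`), and the shifted sum is the unshifted one by periodicity. [folklore] -/
theorem dirSq_gaugeDir_le_of_periodic {P : ℕ} (hP : 1 ≤ P) {W : Site d → Fin d → (Matrix n n ℂ)ˣ} (hW : IsUnitaryCfg W)
    {μ : Site d → Matrix n n ℂ} (hμP : ∀ (y : Site d) (i : Fin d), μ (y + (P : ℤ) • e i) = μ y) :
    dirSq (gaugeDir W μ) (periodBox (d := d) P) ≤ 4 * (d : ℝ) * ∑ z ∈ periodBox (d := d) P, ‖μ z‖ ^ 2 := by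
  have hpt : ∀ (z : Site d) (κ : Fin d), ‖gaugeDir W μ z κ‖ ^ 2 ≤ 2 * ‖μ z‖ ^ 2 + 2 * ‖μ (z + e κ)‖ ^ 2 := by
    intro z κ
    have h := norm_gaugeDir_le hW μ z κ
    have h0 : 0 ≤ ‖gaugeDir W μ z κ‖ := norm_nonneg _
    set a : ℝ := ‖μ z‖ with ha
    set b : ℝ := ‖μ (z + e κ)‖ with hb
    set g : ℝ := ‖gaugeDir W μ z κ‖ with hg
    have h1 : g ^ 2 ≤ (a + b) ^ 2 := pow_le_pow_left₀ h0 h 2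
    nlinarith [h1, sq_nonneg (a - b)]
  have hg : ∀ (y : Site d) (i : Fin d), ‖μ (y + (P : ℤ) • e i)‖ ^ 2 = ‖μ y‖ ^ 2 := by
    intro y i; rw [hμP]
  have hshift : ∀ κ : Fin d, ∑ z ∈ periodBox (d := d) P, ‖μ (z + e κ)‖ ^ 2 = ∑ z ∈ periodBox (d := d) P, ‖μ z‖ ^ 2 :=
    fun κ => sum_periodBox_shift P hP (g := fun w => ‖μ w‖ ^ 2) hg (e κ)
  set S : ℝ := ∑ z ∈ periodBox (d := d) P, ‖μ z‖ ^ 2 with hS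
  have hA : ∑ z ∈ periodBox (d := d) P, ∑ _κ : Fin d, 2 * ‖μ z‖ ^ 2 = 2 * (d : ℝ) * S := by
    rw [hS, Finset.mul_sum]
    refine Finset.sum_congr rfl fun z _ => ?_
    rw [Finset.sum_const, Finset.card_univ, Fintype.card_fin, nsmul_eq_mul]; ring
  have hB : ∑ z ∈ periodBox (d := d) P, ∑ κ : Fin d, 2 * ‖μ (z + e κ)‖ ^ 2 = 2 * (d : ℝ) * S := by
    rw [Finset.sum_comm]
    have e1 : ∀ κ : Fin d, ∑ z ∈ periodBox (d := d) P, 2 * ‖μ (z + e κ)‖ ^ 2 = 2 * S := by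
      intro κ; rw [← Finset.mul_sum, hshift κ]
    rw [Finset.sum_congr rfl fun κ _ => e1 κ, Finset.sum_const, Finset.card_univ, Fintype.card_fin, nsmul_eq_mul]; ring
  unfold dirSq
  calc ∑ z ∈ periodBox (d := d) P, ∑ κ : Fin d, ‖gaugeDir W μ z κ‖ ^ 2
      ≤ ∑ z ∈ periodBox (d := d) P, ∑ κ : Fin d, (2 * ‖μ z‖ ^ 2 + 2 * ‖μ (z + e κ)‖ ^ 2) :=
        Finset.sum_le_sum fun z _ => Finset.sum_le_sum fun κ _ => hpt z κ
    _ = ∑ z ∈ periodBox (d := d) P, ∑ _κ : Fin d, 2 * ‖μ z‖ ^ 2 + ∑ z ∈ periodBox (d := d) P, ∑ κ : Fin d, 2 * ‖μ (z + e κ)‖ ^ 2 := by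
        rw [← Finset.sum_add_distrib]
        exact Finset.sum_congr rfl fun z _ => Finset.sum_add_distrib
    _ = 4 * (d : ℝ) * S := by rw [hA, hB]; ring

/-- **THE ℓ¹ CURL OF A GAUGE DIRECTION** (`W` unitary with `SmallField W x`): `Σ_{p∈perWin P}‖curl_W (gaugeDir W μ) p‖ ≤ 2x·#Plane·Σ_{z∈[0,P)^d}‖μ z‖` — the linearised curl of
a gauge direction is the commutator of the generator with the plaquette deviation (`NE3CurlOfGaugeDir.norm_curlAt_gaugeDir_le`). [folklore] -/
theorem sum_norm_curl_gaugeDir_le [Nonempty n] (P : ℕ) {W : Site d → Fin d → (Matrix n n ℂ)ˣ} (hW : IsUnitaryCfg W) {x : ℝ} (hWx : SmallField W x)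
    (μ : Site d → Matrix n n ℂ) :
    ∑ p ∈ perWin d P, ‖curl W (gaugeDir W μ) p‖ ≤ 2 * x * (Fintype.card (T4AveragingDeficitWall.Plane d)) * ∑ z ∈ periodBox (d := d) P, ‖μ z‖ := by
  unfold perWin
  rw [Finset.sum_product]
  have hpt : ∀ (z : Site d) (π : T4AveragingDeficitWall.Plane d), ‖curl W (gaugeDir W μ) (z, π)‖ ≤ 2 * x * ‖μ z‖ := by
    intro z π
    have hne : π.1.1 ≠ π.1.2 := ne_of_lt π.2
    exact norm_curlAt_gaugeDir_le hW hWx μ z hne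
  calc ∑ z ∈ periodBox (d := d) P, ∑ π : T4AveragingDeficitWall.Plane d, ‖curl W (gaugeDir W μ) (z, π)‖
      ≤ ∑ z ∈ periodBox (d := d) P, ∑ _π : T4AveragingDeficitWall.Plane d, 2 * x * ‖μ z‖ :=
        Finset.sum_le_sum fun z _ => Finset.sum_le_sum fun π _ => hpt z π
    _ = 2 * x * (Fintype.card (T4AveragingDeficitWall.Plane d)) * ∑ z ∈ periodBox (d := d) P, ‖μ z‖ := by
        rw [Finset.mul_sum]
        refine Finset.sum_congr rfl fun z _ => ?_
        rw [Finset.sum_const, Finset.card_univ, nsmul_eq_mul]; ring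

/-! ## §2 The two letters of a pure gauge piece in the binder's energy currency -/

/-- **THE ν-LETTER OF A PURE GAUGE PIECE** (level `j+1`, `M = L^{j+1}`, `L ≥ 1`, `W` unitary with `SmallField W x`, `μ` with `(N·M)`-periodic values, ℓ² mass
`Σ_{[0,N·M)^d}‖μ‖² ≤ m₂`): `‖gaugeDir W μ‖_w ≤ √((4x²·#Plane + 4d·M⁻²)·m₂)`.  In S5 the mass `m₂` of leaf-02's generator is `O(M²)`-extensive against `‖X‖_w²`, so the letter
reads `ν_μ = O(√(x²M²·#Plane + d)·(m₂∕(M²‖X‖_w²))^{1∕2})`. [folklore] -/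
theorem energyNormW_gaugeDir_le [Nonempty n] {L N : ℕ} (hL : 1 ≤ L) (hN : 1 ≤ N) (j : ℕ) {W : Site d → Fin d → (Matrix n n ℂ)ˣ} (hW : IsUnitaryCfg W)
    {x : ℝ} (hWx : SmallField W x) {μ : Site d → Matrix n n ℂ}
    (hμP : ∀ (y : Site d) (i : Fin d), μ (y + ((N * L ^ (j + 1) : ℕ) : ℤ) • e i) = μ y) {m₂ : ℝ}
    (hm₂ : ∑ z ∈ periodBox (d := d) (N * L ^ (j + 1)), ‖μ z‖ ^ 2 ≤ m₂) :
    energyNormW L (j + 1) W (gaugeDir W μ) (periodBox (d := d) (N * L ^ (j + 1)))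
      ≤ Real.sqrt ((4 * x ^ 2 * (Fintype.card (T4AveragingDeficitWall.Plane d)) + 4 * (d : ℝ) * (((L : ℝ) ^ (j + 1))⁻¹) ^ 2) * m₂) := by
  have hP : 1 ≤ N * L ^ (j + 1) := Nat.one_le_iff_ne_zero.mpr (Nat.mul_ne_zero (by omega) (pow_ne_zero _ (by omega)))
  set F := periodBox (d := d) (N * L ^ (j + 1)) with hF
  set S2 : ℝ := ∑ z ∈ F, ‖μ z‖ ^ 2 with hS2
  have hS20 : 0 ≤ S2 := Finset.sum_nonneg fun _ _ => by positivity
  have hm₂0 : 0 ≤ m₂ := hS20.trans hm₂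
  set Pc : ℝ := (Fintype.card (T4AveragingDeficitWall.Plane d) : ℝ) with hPc
  have hPc0 : 0 ≤ Pc := by rw [hPc]; positivity
  have hcurl : curlSq W (gaugeDir W μ) F ≤ 4 * x ^ 2 * Pc * S2 := curlSq_gaugeDir_le hW hWx μ F
  have hdir : dirSq (gaugeDir W μ) F ≤ 4 * (d : ℝ) * S2 := dirSq_gaugeDir_le_of_periodic hP hW hμP
  set c : ℝ := Real.sqrt ((4 * x ^ 2 * Pc + 4 * (d : ℝ) * (((L : ℝ) ^ (j + 1))⁻¹) ^ 2) * m₂) with hc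
  have hc0 : 0 ≤ c := Real.sqrt_nonneg _
  refine energyNormW_le_of_sq_le L j W _ F hc0 ?_
  rw [hc, Real.sq_sqrt (by positivity)]
  calc curlSq W (gaugeDir W μ) F + (((L : ℝ) ^ (j + 1))⁻¹) ^ 2 * dirSq (gaugeDir W μ) F
      ≤ 4 * x ^ 2 * Pc * S2 + (((L : ℝ) ^ (j + 1))⁻¹) ^ 2 * (4 * (d : ℝ) * S2) := add_le_add hcurl (mul_le_mul_of_nonneg_left hdir (by positivity))
    _ = (4 * x ^ 2 * Pc + 4 * (d : ℝ) * (((L : ℝ) ^ (j + 1))⁻¹) ^ 2) * S2 := by ring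
    _ ≤ (4 * x ^ 2 * Pc + 4 * (d : ℝ) * (((L : ℝ) ^ (j + 1))⁻¹) ^ 2) * m₂ := mul_le_mul_of_nonneg_left hm₂ (by positivity)

/-- **THE κ-LETTER OF A PURE GAUGE PIECE** (`W` unitary with `SmallField W x`, `x ≥ 0`; ℓ¹ mass `Σ_{[0,P)^d}‖μ‖ ≤ m₁`): `x·Σ_{perWin P}‖curl_W (gaugeDir W μ)‖ ≤ 2x²·#Plane·m₁` —
with `x = ε∕M²` and `m₁ = O(M²)`-extensive against `‖X‖_w²` (the Green's-function letter (G-ℓ¹) of memo §2) this is the `ε²M⁻²`-room of ROAD-G97 §2 (R4). [folklore] -/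
theorem curlL1_gaugeDir_le [Nonempty n] (P : ℕ) {W : Site d → Fin d → (Matrix n n ℂ)ˣ} (hW : IsUnitaryCfg W) {x : ℝ} (hx : 0 ≤ x) (hWx : SmallField W x)
    (μ : Site d → Matrix n n ℂ) {m₁ : ℝ} (hm₁ : ∑ z ∈ periodBox (d := d) P, ‖μ z‖ ≤ m₁) :
    x * ∑ p ∈ perWin d P, ‖curl W (gaugeDir W μ) p‖ ≤ 2 * x ^ 2 * (Fintype.card (T4AveragingDeficitWall.Plane d)) * m₁ := by
  have h := sum_norm_curl_gaugeDir_le P hW hWx μ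
  have hPc0 : 0 ≤ (Fintype.card (T4AveragingDeficitWall.Plane d) : ℝ) := by positivity
  calc x * ∑ p ∈ perWin d P, ‖curl W (gaugeDir W μ) p‖
      ≤ x * (2 * x * (Fintype.card (T4AveragingDeficitWall.Plane d)) * ∑ z ∈ periodBox (d := d) P, ‖μ z‖) := mul_le_mul_of_nonneg_left h hx
    _ ≤ x * (2 * x * (Fintype.card (T4AveragingDeficitWall.Plane d)) * m₁) := by gcongr
    _ = 2 * x ^ 2 * (Fintype.card (T4AveragingDeficitWall.Plane d)) * m₁ := by ring

end

end Summit.QuantumFields.BalabanUV.T4Continuum.NE7PureGaugePieceLetters
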